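import Literature.MathematicalPhysics.QuantumFieldTheory.Balaban1983to89.B12Rep526Analytic
import Literature.MathematicalPhysics.QuantumFieldTheory.Balaban1983to89.B4Green244

/-!
# `Balaban1983to89.B12Momentum511` — T. Bałaban, *Renormalization group approach to lattice gauge field theories. I*,
Commun. Math. Phys. **109** (1987) 249–301 [Balaban1987RG1]: the momentum representation (5.11) p. 293 of the vacuum
polarization tensor — `Π̃_{μν}(ζ) = Σ_{x∈ℤ^d} e^{−iζ·x}Π_{μν}(x)`, its `2π`-periodicity, its ANALYTIC EXTENSION to the
polystrip `×_μ{ζ_μ = p_μ + iq_μ : |q_μ| < δ₁}` from the decay (5.10), the inversion formula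
`Π_{μν}(x) = (2π)^{−d}∫_{|p_μ|≤π}dp e^{ix·p}Π̃_{μν}(p)`, and the derivatives `∂/∂p_μ` UNDER THE LATTICE SUM ⇒ the momentum
members of (5.42)/(1.22) `β = −(∂²/∂p_μ∂p_νΠ̃_{μν})(0) = Σ_x Π_{μν}(x)x_μx_ν` — PROVED

statement-level skeleton of published theorems with citation tags; proofs where landed; nothing here is a claim about the Yang–Mills mass gap

PDF held: `paper:balaban1987-cmp109-rg-i-small-field` (journal page = PDF page + 248; p. 293 [PDF 45] and p. 297 [PDF 49]
read as images from the page renders `b2b-balaban-ref1/pages/1987-cmp109-rg-I-small-field/…-p045-x2.png`, `…-p049-x2.png`).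

CITATION HEADER / WHAT IS REPRODUCED.  SKELETON row `B12.Eq5.11` (cell `lit-balaban`, HOME
`run/shared/lean/pub/lit-balaban/`, reader file `lit-balaban-r09/ROWS-B12.md`), so far `typed-existing (PARTIAL: different
formulation — the cell works with moments / generating functions instead of the analytic continuation of the Fourier
transform to |q_μ| < δ₁)`, and the passage named open in the header of `B12Rep537` («The Taylor coefficients of the symbol at
p = 0 are the monomial moments: ∂^γ_p Π̃(0) = (−i)^{|γ|}Σ_x Π(x)x^γ (differentiation under the absolutely convergent sum (5.10)
— the one standard passage NOT formalised here)»).  Unit `lit-balaban-r09` gen 5.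

WHAT IS PRINTED (p. 293 [PDF 45], verbatim; the print writes the momentum-space function WITHOUT a tilde — outside quotation
marks `Π̃` (tilde ours) is the momentum-space function, `Π` the position-space kernel).  *"The representation (4.37) yields
the following inequality |Π_{μν}(x − y)| ≤ O(1)E₀ exp(−δ₁|x − y|), (5.10) with a positive constant δ₁ determined by δ₀, κ,
and M (e.g., δ₁ = 1/2min{δ₀, κM⁻¹}). Take the momentum representation of this tensor
Π_{μν}(p) = Σ_{x∈Z⁴} e^{−ip·x}Π_{μν}(x),  Π_{μν}(x) = (2π)⁻⁴∫dp e^{ix·p}Π_{μν}(p),  (5.11)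
the integration over p with components p_μ satisfying |p_μ| ≤ π. The function Π_{μν}(p) is periodic in variables p_μ,
with the period 2π. By the inequality (5.10) it can be extended as an analytic function to complex variables
ζ_μ = p_μ + iq_μ, |q_μ| < δ₁. This property is the basic reason why we have taken the infinite volume limit in (5.1)."*
p. 294, (5.17): *"z_μ = e^{iζ_μ}, … f_{μν}(z₁, …, z_d) = Π_{μν}((1/i)log z₁, …, (1/i)log z_d)"*.  p. 297, (5.42): *"β =
−(∂²/∂p₁∂p₂ Π₁₂)(0) = −(∂²/∂p_μ∂p_ν Π_{μν})(0) = Σ_{x∈Z⁴} Π_{μν}(x)x_μx_ν for μ ≠ ν. This is the fundamental equality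
defining the β-function."* (= (1.22) p. 264, second and third members).

WHAT IS PROVED (kernel-checked; any `d`; `Π : ℤ^d → ℂ` one component of the tensor; `a` = the decay rate `δ₁` and `M` the
constant of the (5.10)-type bound `ExpBound a M Π` of `GawedzkiKupiainen1985.PeriodicGleason`, = the cell's
`B12Sec2to5.Decay510 Π M δ₁` by `B12Rep537.expBound_of_decay510`).
* §1–§2 `piT Π ζ = Σ_x e^{−iζ·x}Π(x)` ((5.11), `ζ·x` = `B4Green244.phaseC`), the polystrips `PolyStrip`/`ClosedPolyStrip`,
  and the DICTIONARY with the tree's Laurent-series objects: `piT_eq_genFun` (`Π̃(ζ) = Σ_xΠ(x)wˣ` at `w = e^{−iζ}` — the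
  reading of `B12Rep537`) and `piT_eq_f529` ((5.17): `Π̃_{μν}(ζ) = f_{μν}(e^{iζ})`, `B12Rep526Coeff.f529`).
* §3 normal convergence on every closed polystrip `|q_μ| ≤ b`, `b < a` (`summable_norm_piT`, sup bound `norm_piT_le`).
* §4 **periodicity** `Π̃(ζ + 2πe_μ) = Π̃(ζ)` for every complex `ζ` (`piT_periodic`).
* §5 **analytic extension**: `analyticOnNhd_piT` — `Π̃` is analytic (`AnalyticOnNhd ℂ`) on the open polystrip `×_μ{|q_μ| < a}`
  (normally convergent series of entire terms: the tree's Weierstrass theorem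
  `Literature.Analysis.Complex.SCV.analyticOnNhd_tsum_of_summable_norm`); `analyticOnNhd_piT_of_decay510` = the sentence
  «By the inequality (5.10) it can be extended as an analytic function to … |q_μ| < δ₁» for the cell's typed (5.10).
* §6 **inversion**: `latticeKernel_piT` — `(2π)^{−d}∫_{[−π,π]^d} e^{ip·x}Π̃(p)dp = Π(x)` (the tree's `B4ContourShift.latticeKernel`,
  Fubini for the absolutely convergent series + `B4Green244.fourierBox_one` `∫e^{ip·x}dp = (2π)^dδ_{x,0}`).
* §7 **derivatives under the sum**: `pderiv κ F ζ = d/dt F(ζ + te_κ)|_{t=0}` (the complex partial `∂/∂ζ_κ`; its restriction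
  to real increments is the printed `∂/∂p_κ`, `hasDerivAt_piT_coord_real`); `pderiv_piT`: on the open polystrip
  `∂Π̃/∂ζ_κ = (−ix_κΠ)~` (`mulCoord`), which decays at every smaller rate (`expBound_mulCoord`), so the derivatives iterate
  (`pderiv_pderiv_piT`); at `ζ = 0`: `Π̃(0) = Σ_xΠ(x)`, `∂_κΠ̃(0) = −iΣ_x x_κΠ(x)`, **`−∂_μ∂_νΠ̃(0) = Σ_xΠ(x)x_μx_ν`**
  (`neg_pderiv_pderiv_piT_zero`); for the cell's real kernels **`secondMoment_eq_neg_pderiv_pderiv`** (`B12Beta.secondMoment`,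
  the right member of (1.22), IS `−(∂²/∂p_μ∂p_ν)Π̃_{μν}(0)`), and with `B12Rep537.beta_eq_542` the first member of (5.42)
  **`beta_eq_neg_pderiv_pderiv`**: `β = −(∂²/∂p_μ∂p_νΠ̃_{μν})(0)`, `μ ≠ ν`.
* §8 the symmetries written «for the function Π_{μν}(ζ)»: (5.12) `eq512` (from `B12Rep526Coeff.Perm512`/`eq518`), (5.14)
  `eq514` (from `Sym514`), (5.15) `eq515_left`/`eq515_right` (from the Ward identities (5.9), `B12Transverse536.WardB` and its
  forward twin, via `genFun_delta`/`B12Rep537.genFun_fdelta`); v1.1 (§9, append-only): (5.13) `eq513` — the reflection law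
  `Π̃_{μν}(εζ) = ε_με_ν e^{−i((1−ε_μ)/2)ζ_μ} e^{i((1−ε_ν)/2)ζ_ν} Π̃_{μν}(ζ)` from the position-space law (5.7)/(5.19) typed as
  `B12Rep526Coeff.Cov519` (for the cell's real kernels: from `B12Transverse536.ReflCovariant`, `eq513_of_reflCovariant`).
Nothing printed is used as a hypothesis except the (5.10)-type bound and, in §8, the position-space symmetries (5.6), (5.8),
(5.9) in their typed forms; no `Prop` placeholder; axioms standard.
-/

namespace Literature.MathematicalPhysics.QuantumFieldTheory.Balaban1983to89.B12Momentum511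

noncomputable section

open Complex MeasureTheory
open scoped Real
open Literature.MathematicalPhysics.QuantumFieldTheory.GawedzkiKupiainen1985.PeriodicGleason
open Literature.MathematicalPhysics.QuantumFieldTheory.Balaban1983to89.B12Rep526 (permZ)
open Literature.MathematicalPhysics.QuantumFieldTheory.Balaban1983to89.B12Rep526Coeff (f529 Perm512 Sym514 eq518)
open Literature.MathematicalPhysics.QuantumFieldTheory.Balaban1983to89.B12Rep526Analytic (OpenPolyAnnulus
  exists_openPolyAnnulus_lt)
open Literature.MathematicalPhysics.QuantumFieldTheory.Balaban1983to89.B4Strip (ofRealVec)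
open Literature.MathematicalPhysics.QuantumFieldTheory.Balaban1983to89.B4ContourShift (BZ phase integrand fourierBox
  latticeKernel norm_cexp_phase)
open Literature.MathematicalPhysics.QuantumFieldTheory.Balaban1983to89.B4Green244 (phaseC phaseC_ofRealVec
  fourierBox_one)

variable {d : ℕ}

/-! ## §1. The objects of (5.11) -/

/-- **(5.11), first formula**, p. 293 [PDF 45], verbatim: *"Take the momentum representation of this tensor
Π_{μν}(p) = Σ_{x∈Z⁴} e^{−ip·x}Π_{μν}(x), …"* — typed reading: for a lattice kernel `Π : ℤ^d → ℂ` (one component `Π_{μν}`;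
any `d`) and a COMPLEX momentum `ζ ∈ ℂ^d` (the printed real `p`, and the printed extension `ζ_μ = p_μ + iq_μ`),
`Π̃(ζ) = Σ_{x∈ℤ^d} e^{−iζ·x}Π(x)` with `ζ·x = Σ_μ ζ_μx_μ` (= `B4Green244.phaseC ζ x`); a `tsum`, i.e. the sum where the series
converges (it does, normally, on every closed polystrip `|q_μ| ≤ b < δ₁`: `summable_norm_piT`).
[cite: Balaban1987RG1, (5.11) p.293] -/
def piT (P : Pt d → ℂ) (ζ : Fin d → ℂ) : ℂ := ∑' x, cexp (-(I * phaseC ζ x)) * P x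

/-- The open polystrip `×_μ{ζ_μ = p_μ + iq_μ : |q_μ| < b}` of (5.11) («complex variables ζ_μ = p_μ + iq_μ, |q_μ| < δ₁»).
[cite: Balaban1987RG1, (5.11) p.293] -/
def PolyStrip (d : ℕ) (b : ℝ) : Set (Fin d → ℂ) := {ζ | ∀ μ, |(ζ μ).im| < b}

/-- The closed polystrip `×_μ{|q_μ| ≤ b}` (the closed sub-polystrips, `b < δ₁`, on which the series (5.11) converges
normally). [cite: Balaban1987RG1, (5.11) p.293] -/
def ClosedPolyStrip (d : ℕ) (b : ℝ) : Set (Fin d → ℂ) := {ζ | ∀ μ, |(ζ μ).im| ≤ b}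

/-- `e^{−iζ}` coordinatewise, `(e^{−iζ})_κ = e^{−iζ_κ}`: the point `w` at which the Laurent series `Σ_xΠ(x)wˣ` of [43]
(`PeriodicGleason.genFun`, the reading of `B12Rep537`: «With w_j = e^{−iζ_j} the symbol is the generating function») IS
(5.11) — `piT_eq_genFun`. [cite: Balaban1987RG1, (5.11) p.293] -/
def expNegI (ζ : Fin d → ℂ) : Fin d → ℂ := fun κ => cexp (-(I * ζ κ))

/-- `e^{iζ}` coordinatewise: the substitution «z_μ = e^{iζ_μ}» of (5.17). [cite: Balaban1987RG1, (5.17) p.294] -/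
def expI (ζ : Fin d → ℂ) : Fin d → ℂ := fun κ => cexp (I * ζ κ)

/-- The open polystrip lies in the closed one. [cite: Balaban1987RG1, (5.11) p.293] -/
theorem polyStrip_subset_closed {b : ℝ} : PolyStrip d b ⊆ ClosedPolyStrip d b := fun _ h μ => (h μ).le

/-- Closed polystrips increase with the width. [cite: Balaban1987RG1, (5.11) p.293] -/
theorem closedPolyStrip_mono {b b' : ℝ} (h : b ≤ b') : ClosedPolyStrip d b ⊆ ClosedPolyStrip d b' :=
  fun _ hζ μ => (hζ μ).trans h

/-- Real momenta `p` (the printed `p ∈ [−π,π]^d`, or any real `p`) lie in every polystrip of positive width.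
[cite: Balaban1987RG1, (5.11) p.293] -/
theorem ofRealVec_mem_polyStrip {b : ℝ} (hb : 0 < b) (p : Fin d → ℝ) : ofRealVec p ∈ PolyStrip d b := fun μ => by
  simpa [ofRealVec] using hb

/-- Real momenta lie in the closed polystrip of width `0`. [cite: Balaban1987RG1, (5.11) p.293] -/
theorem ofRealVec_mem_closedPolyStrip (p : Fin d → ℝ) : ofRealVec p ∈ ClosedPolyStrip d 0 := fun μ => by
  simp [ofRealVec]

/-- `0 ∈ ×_μ{|q_μ| < b}` for `b > 0` (the point of (5.42)). [cite: Balaban1987RG1, (5.42) p.297] -/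
theorem zero_mem_polyStrip {b : ℝ} (hb : 0 < b) : (0 : Fin d → ℂ) ∈ PolyStrip d b := fun μ => by
  simpa using hb

/-- The open polystrip is open. [cite: Balaban1987RG1, (5.11) p.293] -/
theorem isOpen_polyStrip (d : ℕ) (b : ℝ) : IsOpen (PolyStrip d b) := by
  have : PolyStrip d b = ⋂ μ, {ζ : Fin d → ℂ | |(ζ μ).im| < b} := by
    ext ζ; simp [PolyStrip]
  rw [this]
  exact isOpen_iInter_of_finite fun μ =>
    isOpen_lt (continuous_abs.comp (Complex.continuous_im.comp (continuous_apply μ))) continuous_const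

/-! ## §2. The dictionary with the Laurent series of [43] and with (5.17) -/

/-- `|e^{−iζ_κ}| = e^{q_κ}` (`q = Im ζ`). [cite: Balaban1987RG1, (5.11) p.293] -/
theorem norm_expNegI (ζ : Fin d → ℂ) (κ : Fin d) : ‖expNegI ζ κ‖ = Real.exp (ζ κ).im := by
  rw [expNegI, Complex.norm_exp]
  congr 1
  simp

/-- `|e^{iζ_κ}| = e^{−q_κ}`. [cite: Balaban1987RG1, (5.17) p.294] -/
theorem norm_expI (ζ : Fin d → ℂ) (κ : Fin d) : ‖expI ζ κ‖ = Real.exp (-(ζ κ).im) := by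
  rw [expI, Complex.norm_exp]
  congr 1
  simp

/-- `|q_μ| ≤ b` for all `μ` ⇒ `e^{−iζ}` lies in the closed poly-annulus `e^{−b} ≤ |w_μ| ≤ e^{b}` of [43].
[cite: Balaban1987RG1, (5.11) p.293] -/
theorem expNegI_mem_polyAnnulus {b : ℝ} {ζ : Fin d → ℂ} (hζ : ζ ∈ ClosedPolyStrip d b) :
    expNegI ζ ∈ PolyAnnulus d b := by
  intro κ
  rw [norm_expNegI]
  obtain ⟨h1, h2⟩ := abs_le.mp (hζ κ)
  exact ⟨Real.exp_le_exp.mpr h1, Real.exp_le_exp.mpr h2⟩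

/-- `ζ` lies in the open polystrip of width `b` iff `e^{−iζ}` lies in the open polyring `e^{−b} < |w_μ| < e^{b}`.
[cite: Balaban1987RG1, (5.11) p.293] -/
theorem expNegI_mem_openPolyAnnulus_iff {b : ℝ} {ζ : Fin d → ℂ} :
    expNegI ζ ∈ OpenPolyAnnulus d b ↔ ζ ∈ PolyStrip d b := by
  simp only [OpenPolyAnnulus, PolyStrip, Set.mem_setOf_eq, norm_expNegI, Real.exp_lt_exp, abs_lt]

/-- `|q_μ| < b` for all `μ` ⇒ `z = e^{iζ}` lies in the open polyring `×_μ{e^{−b} < |z_μ| < e^{b}}` of (5.17).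
[cite: Balaban1987RG1, (5.17) p.294] -/
theorem expI_mem_openPolyAnnulus {b : ℝ} {ζ : Fin d → ℂ} (hζ : ζ ∈ PolyStrip d b) :
    expI ζ ∈ OpenPolyAnnulus d b := by
  intro κ
  rw [norm_expI]
  obtain ⟨h1, h2⟩ := abs_lt.mp (hζ κ)
  exact ⟨Real.exp_lt_exp.mpr (by linarith), Real.exp_lt_exp.mpr (by linarith)⟩

/-- Every point of the open polystrip of width `a` lies in an open polystrip of width `b < a`.
[cite: Balaban1987RG1, (5.11) p.293] -/
theorem exists_polyStrip_lt {a : ℝ} {ζ : Fin d → ℂ} (hζ : ζ ∈ PolyStrip d a) : ∃ b, b < a ∧ ζ ∈ PolyStrip d b := by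
  obtain ⟨b, hba, hb⟩ := exists_openPolyAnnulus_lt (expNegI_mem_openPolyAnnulus_iff.mpr hζ)
  exact ⟨b, hba, expNegI_mem_openPolyAnnulus_iff.mp hb⟩

/-- `(e^{−iζ})ˣ = e^{−iζ·x}`. [cite: Balaban1987RG1, (5.11) p.293] -/
theorem zpowv_expNegI (ζ : Fin d → ℂ) (x : Pt d) : zpowv (expNegI ζ) x = cexp (-(I * phaseC ζ x)) := by
  unfold zpowv expNegI phaseC
  rw [Finset.mul_sum, ← Finset.sum_neg_distrib, Complex.exp_sum]
  refine Finset.prod_congr rfl fun κ _ => ?_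
  rw [← Complex.exp_int_mul]
  congr 1
  ring

/-- `(e^{iζ})^{−x} = e^{−iζ·x}`. [cite: Balaban1987RG1, (5.17) p.294] -/
theorem zpowv_expI_neg (ζ : Fin d → ℂ) (x : Pt d) : zpowv (expI ζ) (-x) = cexp (-(I * phaseC ζ x)) := by
  unfold zpowv expI phaseC
  rw [Finset.mul_sum, ← Finset.sum_neg_distrib, Complex.exp_sum]
  refine Finset.prod_congr rfl fun κ _ => ?_
  rw [Pi.neg_apply, ← Complex.exp_int_mul]
  congr 1
  push_cast
  ring

/-- **DICTIONARY with [43] / `B12Rep537`**: (5.11) is the Laurent series `Σ_xΠ(x)wˣ` at `w = e^{−iζ}`.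
[cite: Balaban1987RG1, (5.11) p.293] -/
theorem piT_eq_genFun (P : Pt d → ℂ) (ζ : Fin d → ℂ) : piT P ζ = genFun P (expNegI ζ) := by
  unfold piT genFun
  exact tsum_congr fun x => by rw [zpowv_expNegI, mul_comm]

/-- **(5.17) DICTIONARY**: «f_{μν}(z₁,…,z_d) = Π_{μν}((1/i)log z₁,…,(1/i)log z_d)», i.e. `Π̃_{μν}(ζ) = f_{μν}(e^{iζ})` with
`f_{μν}` = (5.29) = `B12Rep526Coeff.f529`. [cite: Balaban1987RG1, (5.17) p.294] -/
theorem piT_eq_f529 (c : Fin d → Fin d → Pt d → ℂ) (μ ν : Fin d) (ζ : Fin d → ℂ) :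
    piT (c μ ν) ζ = f529 c μ ν (expI ζ) := by
  unfold piT f529
  exact tsum_congr fun x => by rw [zpowv_expI_neg, mul_comm]

/-! ## §3. Convergence of (5.11) on the closed polystrips `|q_μ| ≤ b`, `b < δ₁` -/

/-- `|e^{−iζ·x}| ≤ e^{b|x|₁}` on the closed polystrip of width `b`. [cite: Balaban1987RG1, (5.11) p.293] -/
theorem norm_cexp_phaseC_le {b : ℝ} {ζ : Fin d → ℂ} (hζ : ζ ∈ ClosedPolyStrip d b) (x : Pt d) :
    ‖cexp (-(I * phaseC ζ x))‖ ≤ Real.exp (b * l1 x) := by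
  rw [← zpowv_expNegI]
  exact norm_zpowv_le (expNegI_mem_polyAnnulus hζ) x

/-- The terms of (5.11) are bounded by `M e^{−(a−b)|x|₁}` on the closed polystrip of width `b`, for a kernel with the
(5.10)-type bound `|Π(x)| ≤ M e^{−a|x|₁}`. [cite: Balaban1987RG1, (5.11) p.293] -/
theorem norm_term_le {a M b : ℝ} {P : Pt d → ℂ} (hP : ExpBound a M P) {ζ : Fin d → ℂ}
    (hζ : ζ ∈ ClosedPolyStrip d b) (x : Pt d) : ‖cexp (-(I * phaseC ζ x)) * P x‖ ≤ M * wt (a - b) x := by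
  rw [mul_comm, ← zpowv_expNegI]
  exact hP.norm_mul_zpowv_le (expNegI_mem_polyAnnulus hζ) x

/-- **Normal convergence of (5.11)** on the closed polystrip `|q_μ| ≤ b`, `b < a` («By the inequality (5.10) it can be
extended …»: the series of absolute values converges, uniformly in `ζ` there). [cite: Balaban1987RG1, (5.11) p.293] -/
theorem summable_norm_piT {a M b : ℝ} {P : Pt d → ℂ} (hP : ExpBound a M P) (hab : b < a) {ζ : Fin d → ℂ}
    (hζ : ζ ∈ ClosedPolyStrip d b) : Summable fun x => ‖cexp (-(I * phaseC ζ x)) * P x‖ :=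
  Summable.of_nonneg_of_le (fun _ => norm_nonneg _) (norm_term_le hP hζ)
    ((summable_wt (by linarith) d).mul_left M)

/-- Convergence of (5.11) on the closed polystrip `|q_μ| ≤ b`, `b < a`. [cite: Balaban1987RG1, (5.11) p.293] -/
theorem summable_piT {a M b : ℝ} {P : Pt d → ℂ} (hP : ExpBound a M P) (hab : b < a) {ζ : Fin d → ℂ}
    (hζ : ζ ∈ ClosedPolyStrip d b) : Summable fun x => cexp (-(I * phaseC ζ x)) * P x :=
  (summable_norm_piT hP hab hζ).of_norm

/-- In particular (5.11) converges (absolutely) at every REAL momentum `p` when `a > 0`.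
[cite: Balaban1987RG1, (5.11) p.293] -/
theorem summable_piT_real {a M : ℝ} (ha : 0 < a) {P : Pt d → ℂ} (hP : ExpBound a M P) (p : Fin d → ℝ) :
    Summable fun x => cexp (-(I * phaseC (ofRealVec p) x)) * P x :=
  summable_piT hP ha (ofRealVec_mem_closedPolyStrip p)

/-- The sup bound `|Π̃(ζ)| ≤ M·Z_d(a − b)` on the closed polystrip `|q_μ| ≤ b`, `b < a` (`Z_d` of [43]).
[cite: Balaban1987RG1, (5.11) p.293] -/
theorem norm_piT_le {a M b : ℝ} {P : Pt d → ℂ} (hP : ExpBound a M P) (hab : b < a) {ζ : Fin d → ℂ}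
    (hζ : ζ ∈ ClosedPolyStrip d b) : ‖piT P ζ‖ ≤ M * Zd (a - b) d := by
  rw [piT_eq_genFun]
  exact hP.norm_genFun_le hab (expNegI_mem_polyAnnulus hζ)

/-! ## §4. «The function Π_{μν}(p) is periodic in variables p_μ, with the period 2π» -/

/-- The phase along a coordinate line: `(ζ + te_κ)·x = ζ·x + t x_κ`. [cite: Balaban1987RG1, (5.11) p.293] -/
theorem phaseC_add_smul_single (ζ : Fin d → ℂ) (t : ℂ) (κ : Fin d) (x : Pt d) :
    phaseC (ζ + t • Pi.single κ 1) x = phaseC ζ x + t * (x κ : ℂ) := by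
  unfold phaseC
  have h : ∀ μ, (ζ + t • (Pi.single κ 1 : Fin d → ℂ)) μ * (x μ : ℂ) =
      ζ μ * (x μ : ℂ) + (if μ = κ then t * (x μ : ℂ) else 0) := by
    intro μ
    rw [Pi.add_apply, Pi.smul_apply, Pi.single_apply, smul_eq_mul, add_mul]
    split_ifs <;> simp
  simp_rw [h]
  rw [Finset.sum_add_distrib, Finset.sum_ite_eq' Finset.univ κ, if_pos (Finset.mem_univ κ)]

/-- **(5.11), periodicity** — for EVERY complex `ζ` (no convergence needed: the series are termwise equal):
`Π̃(ζ + 2πe_κ) = Π̃(ζ)`. [cite: Balaban1987RG1, (5.11) p.293] -/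
theorem piT_periodic (P : Pt d → ℂ) (ζ : Fin d → ℂ) (κ : Fin d) :
    piT P (ζ + (2 * π : ℂ) • Pi.single κ 1) = piT P ζ := by
  unfold piT
  refine tsum_congr fun x => ?_
  rw [phaseC_add_smul_single, mul_add, neg_add, Complex.exp_add]
  have h : cexp (-(I * (2 * (π : ℂ) * (x κ : ℂ)))) = 1 := by
    rw [← Complex.exp_int_mul_two_pi_mul_I (-(x κ))]
    congr 1
    push_cast
    ring
  rw [h, mul_one]

/-- Periodicity by integer multiples of `2π` in every coordinate: `Π̃(ζ + 2πn) = Π̃(ζ)`, `n ∈ ℤ^d`.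
[cite: Balaban1987RG1, (5.11) p.293] -/
theorem piT_add_int (P : Pt d → ℂ) (ζ : Fin d → ℂ) (n : Pt d) :
    piT P (fun κ => ζ κ + 2 * π * (n κ : ℂ)) = piT P ζ := by
  unfold piT
  refine tsum_congr fun x => ?_
  have hφ : phaseC (fun κ => ζ κ + 2 * π * (n κ : ℂ)) x = phaseC ζ x + 2 * π * (∑ κ, (n κ : ℂ) * (x κ : ℂ)) := by
    unfold phaseC
    rw [Finset.mul_sum, ← Finset.sum_add_distrib]
    exact Finset.sum_congr rfl fun κ _ => by ring
  rw [hφ, mul_add, neg_add, Complex.exp_add]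
  have h : cexp (-(I * (2 * (π : ℂ) * ∑ κ, (n κ : ℂ) * (x κ : ℂ)))) = 1 := by
    rw [← Complex.exp_int_mul_two_pi_mul_I (-(∑ κ, n κ * x κ))]
    congr 1
    push_cast
    ring
  rw [h, mul_one]

/-! ## §5. «By the inequality (5.10) it can be extended as an analytic function to complex variables
ζ_μ = p_μ + iq_μ, |q_μ| < δ₁» -/

/-- Every term `ζ ↦ e^{−iζ·x}Π(x)` of (5.11) is an entire function of `ζ ∈ ℂ^d`. [cite: Balaban1987RG1, (5.11) p.293] -/
theorem differentiable_term (P : Pt d → ℂ) (x : Pt d) :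
    Differentiable ℂ fun ζ : Fin d → ℂ => cexp (-(I * phaseC ζ x)) * P x := by
  have hφ : Differentiable ℂ fun ζ : Fin d → ℂ => phaseC ζ x := by
    unfold phaseC
    exact Differentiable.fun_sum fun μ _ => (differentiable_apply μ).mul_const _
  exact (hφ.const_mul I).neg.cexp.mul_const _

/-- `Π̃` is analytic on the open polystrip of every width `b < a` (a normally convergent series of entire terms —
Weierstrass). [cite: Balaban1987RG1, (5.11) p.293] -/
theorem analyticOnNhd_piT_of_lt {a M b : ℝ} {P : Pt d → ℂ} (hP : ExpBound a M P) (hab : b < a) :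
    AnalyticOnNhd ℂ (piT P) (PolyStrip d b) := by
  unfold piT
  exact Literature.Analysis.Complex.SCV.analyticOnNhd_tsum_of_summable_norm (isOpen_polyStrip d b)
    (fun x => (differentiable_term P x).differentiableOn) ((summable_wt (by linarith) d).mul_left M)
    fun x ζ hζ => norm_term_le hP (polyStrip_subset_closed hζ) x

/-- **(5.11), the analytic extension** — for a kernel with `|Π(x)| ≤ M e^{−a|x|₁}` the function `Π̃` is analytic on the
open polystrip `×_μ{ζ_μ = p_μ + iq_μ : |q_μ| < a}` («This property is the basic reason why we have taken the infinite
volume limit in (5.1)»). [cite: Balaban1987RG1, (5.11) p.293] -/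
theorem analyticOnNhd_piT {a M : ℝ} {P : Pt d → ℂ} (hP : ExpBound a M P) :
    AnalyticOnNhd ℂ (piT P) (PolyStrip d a) := by
  intro ζ hζ
  obtain ⟨b, hba, hζb⟩ := exists_polyStrip_lt hζ
  exact analyticOnNhd_piT_of_lt hP hba ζ hζb

/-- **«By the inequality (5.10) it can be extended as an analytic function to complex variables ζ_μ = p_μ + iq_μ,
|q_μ| < δ₁»** — for the cell's typed (5.10) `B12Sec2to5.Decay510 Π C δ₁` of a real kernel, `Π̃` is analytic on the open
polystrip of width EXACTLY `δ₁`. [cite: Balaban1987RG1, (5.11) p.293] -/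
theorem analyticOnNhd_piT_of_decay510 {P : Pt d → ℝ} {C δ₁ : ℝ} (h510 : B12Sec2to5.Decay510 P C δ₁) :
    AnalyticOnNhd ℂ (piT (B12Rep537.ofReal P)) (PolyStrip d δ₁) :=
  analyticOnNhd_piT (B12Rep537.expBound_of_decay510 h510)

/-- `Π̃` is complex-differentiable at every point of the open polystrip. [cite: Balaban1987RG1, (5.11) p.293] -/
theorem differentiableAt_piT {a M : ℝ} {P : Pt d → ℂ} (hP : ExpBound a M P) {ζ : Fin d → ℂ}
    (hζ : ζ ∈ PolyStrip d a) : DifferentiableAt ℂ (piT P) ζ :=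
  (analyticOnNhd_piT hP ζ hζ).differentiableAt

/-- `Π̃` is continuous on the open polystrip. [cite: Balaban1987RG1, (5.11) p.293] -/
theorem continuousOn_piT {a M : ℝ} {P : Pt d → ℂ} (hP : ExpBound a M P) : ContinuousOn (piT P) (PolyStrip d a) :=
  (analyticOnNhd_piT hP).continuousOn

/-! ## §6. **(5.11), second formula**: `Π_{μν}(x) = (2π)^{−d}∫_{|p_μ|≤π}dp e^{ix·p}Π̃_{μν}(p)` -/

/-- The phase is additive in the lattice point: `p·(x − y) = p·x − p·y`. [folklore] -/
private theorem phase_sub (p : Fin d → ℝ) (x y : Pt d) : phase p (x - y) = phase p x - phase p y := by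
  unfold phase
  rw [← Finset.sum_sub_distrib]
  exact Finset.sum_congr rfl fun μ _ => by push_cast [Pi.sub_apply]; ring

/-- **(5.11), inversion** — for a kernel with `|Π(x)| ≤ M e^{−a|x|₁}`, `a > 0`:
`(2π)^{−d}∫_{[−π,π]^d} e^{ip·x}Π̃(p)dp = Π(x)` for every `x ∈ ℤ^d`, i.e. `Π` IS the lattice kernel (`B4ContourShift.latticeKernel`)
of its momentum representation («Π_{μν}(x) = (2π)⁻⁴∫dp e^{ix·p}Π_{μν}(p), the integration over p with components p_μ
satisfying |p_μ| ≤ π»).  Proof: the series (5.11) converges absolutely and uniformly on the zone, so sum and integral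
commute (Fubini), and `∫_{[−π,π]^d}e^{ip·(x−y)}dp = (2π)^dδ_{x,y}` (`B4Green244.fourierBox_one`).
[cite: Balaban1987RG1, (5.11) p.293] -/
theorem latticeKernel_piT {a M : ℝ} (ha : 0 < a) {P : Pt d → ℂ} (hP : ExpBound a M P) (x : Pt d) :
    latticeKernel (piT P) x = P x := by
  -- the summands of `e^{ip·x}Π̃(p)`: `F y p = Π(y)e^{ip·(x−y)}`
  have hFcont : ∀ y : Pt d, Continuous fun p : Fin d → ℝ => P y * cexp (I * phase p (x - y)) := fun y => by
    have hph : Continuous fun p : Fin d → ℝ => phase p (x - y) := by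
      unfold phase
      exact continuous_finsetSum _ fun μ _ =>
        (Complex.continuous_ofReal.comp (continuous_apply μ)).mul continuous_const
    exact continuous_const.mul (hph.const_mul I).cexp
  have hFnorm : ∀ (y : Pt d) (p : Fin d → ℝ), ‖P y * cexp (I * phase p (x - y))‖ = ‖P y‖ := fun y p => by
    rw [norm_mul, norm_cexp_phase, mul_one]
  have hterm : ∀ p : Fin d → ℝ, integrand (piT P) x p = ∑' y, P y * cexp (I * phase p (x - y)) := by
    intro p
    show piT P (ofRealVec p) * cexp (I * phase p x) = ∑' y, P y * cexp (I * phase p (x - y))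
    unfold piT
    rw [← tsum_mul_right]
    refine tsum_congr fun y => ?_
    rw [phaseC_ofRealVec, phase_sub, mul_sub, sub_eq_add_neg, Complex.exp_add]
    ring
  have hint : ∀ y : Pt d, Integrable (fun p : Fin d → ℝ => P y * cexp (I * phase p (x - y)))
      (volume.restrict (BZ d)) := fun y =>
    (hFcont y).continuousOn.integrableOn_compact isCompact_Icc
  have hsum : Summable fun y : Pt d => ∫ p in BZ d, ‖P y * cexp (I * phase p (x - y))‖ := by
    simp_rw [hFnorm, setIntegral_const, smul_eq_mul]
    exact (hP.summable_norm ha).mul_left _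
  have hbox : ∀ y : Pt d, ∫ p in BZ d, P y * cexp (I * phase p (x - y)) =
      P y * fourierBox (fun _ => (1 : ℂ)) (x - y) := by
    intro y
    rw [integral_const_mul]
    congr 1
    unfold fourierBox integrand
    simp only [one_mul]
  have hfb : fourierBox (piT P) x = ∑' y, ∫ p in BZ d, P y * cexp (I * phase p (x - y)) := by
    unfold fourierBox
    rw [show integrand (piT P) x = fun p => ∑' y, P y * cexp (I * phase p (x - y)) from funext hterm]
    exact (integral_tsum_of_summable_integral_norm hint hsum).symm
  have hne : (2 * (π : ℂ)) ^ d ≠ 0 :=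
    pow_ne_zero _ (mul_ne_zero two_ne_zero (Complex.ofReal_ne_zero.mpr Real.pi_ne_zero))
  unfold latticeKernel
  rw [hfb]
  simp_rw [hbox, fourierBox_one]
  rw [tsum_eq_single x]
  · rw [sub_self, if_pos rfl, Complex.real_smul]
    push_cast
    rw [inv_mul_eq_iff_eq_mul₀ hne]
    ring
  · intro y hy
    rw [if_neg (fun h => hy (sub_eq_zero.mp h).symm), mul_zero]

/-- The inversion formula for the cell's typed (5.10) (real kernels, `δ₁ > 0`). [cite: Balaban1987RG1, (5.11) p.293] -/
theorem latticeKernel_piT_of_decay510 {P : Pt d → ℝ} {C δ₁ : ℝ} (hδ : 0 < δ₁) (h510 : B12Sec2to5.Decay510 P C δ₁)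
    (x : Pt d) : latticeKernel (piT (B12Rep537.ofReal P)) x = (P x : ℂ) :=
  latticeKernel_piT hδ (B12Rep537.expBound_of_decay510 h510) x

/-! ## §7. Derivatives `∂/∂p_μ` under the lattice sum; (5.42)/(1.22) -/

/-- The (complex) partial derivative along the `κ`-th coordinate, `∂F/∂ζ_κ(ζ) := d/dt F(ζ + te_κ)|_{t=0}`; for `F`
analytic and a real increment `t = s ∈ ℝ` this is the printed `∂/∂p_κ` (see `hasDerivAt_piT_coord_real`).
[cite: Balaban1987RG1, (5.42) p.297] -/
def pderiv (κ : Fin d) (F : (Fin d → ℂ) → ℂ) (ζ : Fin d → ℂ) : ℂ :=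
  deriv (fun t : ℂ => F (ζ + t • Pi.single κ 1)) 0

/-- What `∂/∂ζ_κ` does under the sum (5.11): the kernel is multiplied by `−ix_κ`.
[cite: Balaban1987RG1, (5.42) p.297] -/
def mulCoord (κ : Fin d) (P : Pt d → ℂ) : Pt d → ℂ := fun x => -(I * (x κ : ℂ)) * P x

/-- `|x_κ| ≤ |x|₁`. [folklore] -/
private theorem abs_coord_le_l1 (x : Pt d) (κ : Fin d) : |(x κ : ℝ)| ≤ l1 x :=
  Finset.single_le_sum (f := fun j => |(x j : ℝ)|) (fun _ _ => abs_nonneg _) (Finset.mem_univ κ)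

/-- `|x_κ| ≤ Π_j(|x_j| + 1)` (the weight `pw 1` of [43]). [folklore] -/
private theorem norm_coord_le_pw (x : Pt d) (κ : Fin d) : ‖((x κ : ℤ) : ℂ)‖ ≤ pw 1 x := by
  have h := norm_monom_le (B12Transverse536.ind κ) (p := 1)
    (fun _ => by unfold B12Transverse536.ind; split_ifs <;> simp) x
  rwa [B12Transverse536.monom_ind, one_mul] at h

/-- **The multiplied kernel decays at every smaller rate**: `|−ix_κΠ(x)| ≤ (M/(a − a′))e^{−a′|x|₁}` for `a′ < a` (from
`|x_κ| ≤ |x|₁ ≤ e^{(a−a′)|x|₁}/(a − a′)`) — so the derivatives of (5.11) iterate. [cite: Balaban1987RG1, (5.42) p.297] -/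
theorem expBound_mulCoord {a a' M : ℝ} (haa : a' < a) {P : Pt d → ℂ} (hP : ExpBound a M P) (κ : Fin d) :
    ExpBound a' (M / (a - a')) (mulCoord κ P) := by
  intro x
  have hε : 0 < a - a' := sub_pos.mpr haa
  have h1 : ‖mulCoord κ P x‖ = |(x κ : ℝ)| * ‖P x‖ := by
    rw [mulCoord, norm_mul, norm_neg, norm_mul, Complex.norm_I, one_mul, Complex.norm_intCast]
  have h2 : l1 x ≤ Real.exp ((a - a') * l1 x) / (a - a') := by
    rw [le_div_iff₀ hε, mul_comm]
    linarith [Real.add_one_le_exp ((a - a') * l1 x)]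
  rw [h1]
  calc |(x κ : ℝ)| * ‖P x‖ ≤ l1 x * (M * wt a x) :=
        mul_le_mul (abs_coord_le_l1 x κ) (hP x) (norm_nonneg _) (l1_nonneg x)
    _ ≤ (Real.exp ((a - a') * l1 x) / (a - a')) * (M * wt a x) :=
        mul_le_mul_of_nonneg_right h2 (mul_nonneg hP.nonneg (wt_pos a x).le)
    _ = M / (a - a') * wt a' x := by
        unfold wt
        rw [show -a' * l1 x = (a - a') * l1 x + -a * l1 x by ring, Real.exp_add]
        ring

/-- **Differentiation under the lattice sum.**  On the open polystrip `|q_μ| < a` the function `t ↦ Π̃(ζ + te_κ)` of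
ONE complex variable has at `t = 0` the derivative `Σ_x e^{−iζ·x}(−ix_κ)Π(x)` (the series of derivatives converges
normally on a smaller closed polystrip containing a neighbourhood: Mathlib's `hasDerivAt_tsum_of_isPreconnected`).
[cite: Balaban1987RG1, (5.42) p.297] -/
theorem hasDerivAt_piT_coord {a M : ℝ} {P : Pt d → ℂ} (hP : ExpBound a M P) (κ : Fin d) {ζ : Fin d → ℂ}
    (hζ : ζ ∈ PolyStrip d a) :
    HasDerivAt (fun t : ℂ => piT P (ζ + t • Pi.single κ 1)) (piT (mulCoord κ P) ζ) 0 := by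
  obtain ⟨b, hba, hζb⟩ := exists_polyStrip_lt hζ
  -- the admissible increments: an open horizontal strip of the `t`-plane
  have hT_open : IsOpen {t : ℂ | |(ζ κ).im + t.im| < b} :=
    isOpen_lt (continuous_abs.comp (continuous_const.add Complex.continuous_im)) continuous_const
  have hT_conv : Convex ℝ {t : ℂ | |(ζ κ).im + t.im| < b} := by
    have e : {t : ℂ | |(ζ κ).im + t.im| < b} = {t : ℂ | t.im < b - (ζ κ).im} ∩ {t : ℂ | -b - (ζ κ).im < t.im} := by
      ext t
      simp only [Set.mem_setOf_eq, Set.mem_inter_iff, abs_lt]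
      constructor
      · rintro ⟨h1, h2⟩; constructor <;> linarith
      · rintro ⟨h1, h2⟩; constructor <;> linarith
    rw [e]
    exact (convex_halfSpace_im_lt _).inter (convex_halfSpace_im_gt _)
  have h0T : (0 : ℂ) ∈ {t : ℂ | |(ζ κ).im + t.im| < b} := by
    simpa using hζb κ
  have hmemT : ∀ t ∈ {t : ℂ | |(ζ κ).im + t.im| < b}, ζ + t • Pi.single κ (1 : ℂ) ∈ ClosedPolyStrip d b := by
    intro t ht μ
    by_cases hμ : μ = κ
    · subst hμ
      simpa using le_of_lt ht
    · simpa [hμ] using (hζb μ).le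
  have hg : ∀ (x : Pt d) (t : ℂ), t ∈ {t : ℂ | |(ζ κ).im + t.im| < b} →
      HasDerivAt (fun s : ℂ => cexp (-(I * phaseC (ζ + s • Pi.single κ 1) x)) * P x)
        (-(I * (x κ : ℂ)) * (cexp (-(I * phaseC (ζ + t • Pi.single κ 1) x)) * P x)) t := by
    intro x t _
    have e : (fun s : ℂ => cexp (-(I * phaseC (ζ + s • Pi.single κ 1) x)) * P x)
        = fun s => cexp (-(I * (x κ : ℂ)) * s + -(I * phaseC ζ x)) * P x := by
      funext s
      rw [phaseC_add_smul_single]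
      congr 2
      ring
    rw [e]
    have h1 : HasDerivAt (fun s : ℂ => -(I * (x κ : ℂ)) * s + -(I * phaseC ζ x)) (-(I * (x κ : ℂ))) t := by
      simpa using ((hasDerivAt_id t).const_mul (-(I * (x κ : ℂ)))).add_const (-(I * phaseC ζ x))
    have h2 := h1.cexp.mul_const (P x)
    have e2 : -(I * phaseC (ζ + t • Pi.single κ 1) x) = -(I * (x κ : ℂ)) * t + -(I * phaseC ζ x) := by
      rw [phaseC_add_smul_single]; ring
    have e3 : cexp (-(I * (x κ : ℂ)) * t + -(I * phaseC ζ x)) * -(I * (x κ : ℂ)) * P x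
        = -(I * (x κ : ℂ)) * (cexp (-(I * (x κ : ℂ)) * t + -(I * phaseC ζ x)) * P x) := by ring
    rw [e2, ← e3]
    exact h2
  have hg' : ∀ (x : Pt d) (t : ℂ), t ∈ {t : ℂ | |(ζ κ).im + t.im| < b} →
      ‖-(I * (x κ : ℂ)) * (cexp (-(I * phaseC (ζ + t • Pi.single κ 1) x)) * P x)‖ ≤ M * (wt (a - b) x * pw 1 x) := by
    intro x t ht
    rw [norm_mul]
    have hn1 : ‖-(I * (x κ : ℂ))‖ ≤ pw 1 x := by
      rw [norm_neg, norm_mul, Complex.norm_I, one_mul]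
      exact norm_coord_le_pw x κ
    calc ‖-(I * (x κ : ℂ))‖ * ‖cexp (-(I * phaseC (ζ + t • Pi.single κ 1) x)) * P x‖
        ≤ pw 1 x * (M * wt (a - b) x) :=
          mul_le_mul hn1 (norm_term_le hP (hmemT t ht) x) (norm_nonneg _) (pw_pos 1 x).le
      _ = M * (wt (a - b) x * pw 1 x) := by ring
  have hmain := hasDerivAt_tsum_of_isPreconnected
    (g := fun (x : Pt d) (s : ℂ) => cexp (-(I * phaseC (ζ + s • Pi.single κ 1) x)) * P x)
    (g' := fun (x : Pt d) (t : ℂ) => -(I * (x κ : ℂ)) * (cexp (-(I * phaseC (ζ + t • Pi.single κ 1) x)) * P x))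
    ((summable_wt_pw (by linarith) 1 d).mul_left M) hT_open hT_conv.isPreconnected hg hg' h0T
    (summable_piT hP hba (hmemT 0 h0T)) h0T
  have hval : (∑' x : Pt d, -(I * (x κ : ℂ)) * (cexp (-(I * phaseC (ζ + (0 : ℂ) • Pi.single κ 1) x)) * P x))
      = piT (mulCoord κ P) ζ := by
    unfold piT mulCoord
    refine tsum_congr fun x => ?_
    rw [zero_smul, add_zero]
    ring
  rw [← hval]
  exact hmain

/-- **`∂Π̃/∂ζ_κ = (−ix_κΠ)~` on the open polystrip** `|q_μ| < a`. [cite: Balaban1987RG1, (5.42) p.297] -/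
theorem pderiv_piT {a M : ℝ} {P : Pt d → ℂ} (hP : ExpBound a M P) (κ : Fin d) {ζ : Fin d → ℂ}
    (hζ : ζ ∈ PolyStrip d a) : pderiv κ (piT P) ζ = piT (mulCoord κ P) ζ :=
  (hasDerivAt_piT_coord hP κ hζ).deriv

/-- The printed REAL derivative: for a real increment `s` the function `s ↦ Π̃(ζ + se_κ)` has at `s = 0` the derivative
`∂Π̃/∂ζ_κ(ζ)` (so at real `ζ = p` the complex partial IS `∂/∂p_κ`). [cite: Balaban1987RG1, (5.42) p.297] -/
theorem hasDerivAt_piT_coord_real {a M : ℝ} {P : Pt d → ℂ} (hP : ExpBound a M P) (κ : Fin d) {ζ : Fin d → ℂ}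
    (hζ : ζ ∈ PolyStrip d a) :
    HasDerivAt (fun s : ℝ => piT P (ζ + (s : ℂ) • Pi.single κ 1)) (pderiv κ (piT P) ζ) 0 := by
  rw [pderiv_piT hP κ hζ]
  have h : HasDerivAt (fun t : ℂ => piT P (ζ + t • Pi.single κ 1)) (piT (mulCoord κ P) ζ) ((0 : ℝ) : ℂ) := by
    simpa using hasDerivAt_piT_coord hP κ hζ
  exact h.comp_ofReal

/-- **Second derivatives**: on the open polystrip `∂²Π̃/∂ζ_μ∂ζ_ν = ((−ix_μ)(−ix_ν)Π)~` (the first derivative is again a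
momentum representation, of a kernel decaying at every smaller rate, so §7 applies to it).
[cite: Balaban1987RG1, (5.42) p.297] -/
theorem pderiv_pderiv_piT {a M : ℝ} {P : Pt d → ℂ} (hP : ExpBound a M P) (μ ν : Fin d) {ζ : Fin d → ℂ}
    (hζ : ζ ∈ PolyStrip d a) : pderiv μ (pderiv ν (piT P)) ζ = piT (mulCoord μ (mulCoord ν P)) ζ := by
  obtain ⟨a', ha'a, hζ'⟩ := exists_polyStrip_lt hζ
  have hP' : ExpBound a' (M / (a - a')) (mulCoord ν P) := expBound_mulCoord ha'a hP ν
  have hev : (fun t : ℂ => pderiv ν (piT P) (ζ + t • Pi.single μ 1)) =ᶠ[nhds 0]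
      fun t => piT (mulCoord ν P) (ζ + t • Pi.single μ 1) := by
    have hcont : Continuous fun t : ℂ => ζ + t • (Pi.single μ (1 : ℂ) : Fin d → ℂ) :=
      continuous_const.add (continuous_id.smul continuous_const)
    have hopen : IsOpen ((fun t : ℂ => ζ + t • (Pi.single μ (1 : ℂ) : Fin d → ℂ)) ⁻¹' PolyStrip d a) :=
      (isOpen_polyStrip d a).preimage hcont
    have h0 : (0 : ℂ) ∈ (fun t : ℂ => ζ + t • (Pi.single μ (1 : ℂ) : Fin d → ℂ)) ⁻¹' PolyStrip d a := by
      simpa using hζ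
    filter_upwards [hopen.mem_nhds h0] with t ht
    exact pderiv_piT hP ν ht
  show deriv (fun t : ℂ => pderiv ν (piT P) (ζ + t • Pi.single μ 1)) 0 = _
  rw [hev.deriv_eq]
  exact (hasDerivAt_piT_coord hP' μ hζ').deriv

/-- At `ζ = 0`: `Π̃(0) = Σ_xΠ(x)` (for every kernel; both sides are the same `tsum`). [cite: Balaban1987RG1, (5.11) p.293] -/
theorem piT_zero (P : Pt d → ℂ) : piT P 0 = ∑' x, P x := by
  unfold piT
  refine tsum_congr fun x => ?_
  simp [phaseC]

/-- **First derivatives at `p = 0`**: `∂Π̃/∂p_κ(0) = −iΣ_x x_κΠ(x)`. [cite: Balaban1987RG1, (5.42) p.297] -/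
theorem pderiv_piT_zero {a M : ℝ} (ha : 0 < a) {P : Pt d → ℂ} (hP : ExpBound a M P) (κ : Fin d) :
    pderiv κ (piT P) 0 = -I * ∑' x, (x κ : ℂ) * P x := by
  rw [pderiv_piT hP κ (zero_mem_polyStrip ha), piT_zero]
  unfold mulCoord
  rw [← tsum_mul_left]
  exact tsum_congr fun x => by ring

/-- **(5.42)/(1.22), momentum side** — `−(∂²/∂p_μ∂p_νΠ̃)(0) = Σ_x Π(x)x_μx_ν` for every kernel with a (5.10)-type bound
(any `μ, ν`; differentiation twice under the sum). [cite: Balaban1987RG1, (5.42) p.297] -/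
theorem neg_pderiv_pderiv_piT_zero {a M : ℝ} (ha : 0 < a) {P : Pt d → ℂ} (hP : ExpBound a M P) (μ ν : Fin d) :
    -pderiv μ (pderiv ν (piT P)) 0 = ∑' x, P x * ((x μ : ℂ) * (x ν : ℂ)) := by
  rw [pderiv_pderiv_piT hP μ ν (zero_mem_polyStrip ha), piT_zero]
  unfold mulCoord
  rw [← tsum_neg]
  exact tsum_congr fun x => by linear_combination (-((x μ : ℂ) * (x ν : ℂ) * P x)) * Complex.I_mul_I

/-- **(1.22) = (5.42), second = third member, for the cell's real kernels**: if the component `Π_{μν}` has the typed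
(5.10) decay `B12Sec2to5.Decay510 (Π μ ν) C δ₁`, `δ₁ > 0`, then `B12Beta.secondMoment Π μ ν = Σ_x Π_{μν}(x)x_μx_ν`
(the right member of (1.22) p. 264) IS `−(∂²/∂p_μ∂p_ν)Π̃_{μν}(0)`. [cite: Balaban1987RG1, (5.42) p.297] -/
theorem secondMoment_eq_neg_pderiv_pderiv {P : B12Beta.Kernel d} {C δ₁ : ℝ} (hδ : 0 < δ₁) {μ ν : Fin d}
    (h510 : B12Sec2to5.Decay510 (P μ ν) C δ₁) :
    ((B12Beta.secondMoment P μ ν : ℝ) : ℂ) = -pderiv μ (pderiv ν (piT (B12Rep537.ofReal (P μ ν)))) 0 := by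
  rw [neg_pderiv_pderiv_piT_zero hδ (B12Rep537.expBound_of_decay510 h510), B12Beta.secondMoment,
    Complex.ofReal_tsum]
  exact tsum_congr fun x => by simp only [B12Rep537.ofReal]; push_cast; ring

/-- **(5.42), first member** — «β = −(∂²/∂p₁∂p₂ Π₁₂)(0) = −(∂²/∂p_μ∂p_ν Π_{μν})(0) … for μ ≠ ν. This is the fundamental
equality defining the β-function»: for a kernel with a (5.10)-type bound whose second-order Taylor data are `β ×` those
of the leading form (5.36)/(5.37) (`B12Rep537.TaylorData3`), `β = −(∂²/∂p_μ∂p_νΠ̃_{μν})(0)`, `μ ≠ ν` (the position-space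
member is `B12Rep537.beta_eq_542`). [cite: Balaban1987RG1, (5.42) p.297] -/
theorem beta_eq_neg_pderiv_pderiv {a M : ℝ} (ha : 0 < a) {P : Pt d → ℂ} (hP : ExpBound a M P) {β : ℂ}
    {μ ν : Fin d} (hT : B12Rep537.TaylorData3 β μ ν P) (hμν : μ ≠ ν) :
    β = -pderiv μ (pderiv ν (piT P)) 0 := by
  rw [neg_pderiv_pderiv_piT_zero ha hP μ ν]
  exact B12Rep537.beta_eq_542 hT hμν

/-! ## §8. «Let us write the symmetry properties (5.6)–(5.9) for the function Π_{μν}(ζ)» -/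

/-- «where ∂_μ(ζ) = e^{iζ_μ} − 1» (the symbol of the forward lattice derivative). [cite: Balaban1987RG1, (5.15) p.293] -/
def dSym (ζ : Fin d → ℂ) (μ : Fin d) : ℂ := cexp (I * ζ μ) - 1

/-- **(5.12)** «Π_{μν}(rζ) = ((r⊗r)Π)_{μν}(ζ) if r is a permutation»: with `(rζ)_μ = ζ_{r⁻¹μ}` (`B12Rep526.permZ`) and
`((r⊗r)Π̃)_{μν} = Π̃_{r⁻¹μ,r⁻¹ν}` as in (5.6), from the position-space permutation covariance (5.6)/(5.12) typed as
`B12Rep526Coeff.Perm512`; at EVERY `ζ ∈ ℂ^d`. [cite: Balaban1987RG1, (5.12) p.293] -/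
theorem eq512 (c : Fin d → Fin d → Pt d → ℂ) (hP : Perm512 c) (r : Equiv.Perm (Fin d)) (μ ν : Fin d)
    (ζ : Fin d → ℂ) : piT (c μ ν) (permZ r ζ) = piT (c (r.symm μ) (r.symm ν)) ζ := by
  rw [piT_eq_f529, piT_eq_f529, ← eq518 c hP r μ ν]
  congr 1

/-- **(5.14)** «Π_{μν}(ζ) = Π_{νμ}(−ζ)», from the symmetry (5.8) `Π_{μν}(x) = Π_{νμ}(−x)` typed as `B12Rep526Coeff.Sym514`;
at EVERY `ζ ∈ ℂ^d`. [cite: Balaban1987RG1, (5.14) p.293] -/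
theorem eq514 (c : Fin d → Fin d → Pt d → ℂ) (hS : Sym514 c) (μ ν : Fin d) (ζ : Fin d → ℂ) :
    piT (c μ ν) ζ = piT (c ν μ) (-ζ) := by
  unfold piT
  rw [← (Equiv.neg (Pt d)).tsum_eq (fun x => cexp (-(I * phaseC (-ζ) x)) * c ν μ x)]
  refine tsum_congr fun x => ?_
  have hφ : phaseC (-ζ) (-x) = phaseC ζ x := by
    unfold phaseC
    exact Finset.sum_congr rfl fun κ _ => by simp only [Pi.neg_apply, Int.cast_neg, neg_mul_neg]
  rw [Equiv.neg_apply, hS μ ν x, hφ]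

/-- **(5.15), first member** «Σ_μ ∂_μ(−ζ)Π_{μν}(ζ) = 0» on the open polystrip `|q_μ| < a`, from the gauge-invariance Ward
identity (5.9) `Σ_μ ∂*_μΠ_{μν} = 0` (typed `B12Transverse536.WardB`: `Σ_μ Δ_μΠ_{μν} = 0`, `Δ_μ` the backward difference of
[43], whose symbol at `w = e^{−iζ}` is `w_μ − 1 = ∂_μ(−ζ)`: `PeriodicGleason.genFun_delta`).
[cite: Balaban1987RG1, (5.15) p.293] -/
theorem eq515_left {a M : ℝ} (ha : 0 < a) {c : Fin d → Fin d → Pt d → ℂ} (hc : ∀ μ ν, ExpBound a M (c μ ν))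
    (hW : B12Transverse536.WardB c) (ν : Fin d) {ζ : Fin d → ℂ} (hζ : ζ ∈ PolyStrip d a) :
    ∑ μ, dSym (-ζ) μ * piT (c μ ν) ζ = 0 := by
  obtain ⟨b, hba, hζb⟩ := exists_polyStrip_lt hζ
  have hw : expNegI ζ ∈ PolyAnnulus d b := expNegI_mem_polyAnnulus (polyStrip_subset_closed hζb)
  have hd : ∀ μ, dSym (-ζ) μ = expNegI ζ μ - 1 := fun μ => by simp [dSym, expNegI]
  have hs : ∀ μ ∈ (Finset.univ : Finset (Fin d)),
      Summable fun n => delta μ (c μ ν) n * zpowv (expNegI ζ) n :=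
    fun μ _ => (delta_bound ha (hc μ ν) μ).summable_mul_zpowv hba hw
  calc ∑ μ, dSym (-ζ) μ * piT (c μ ν) ζ = ∑ μ, genFun (delta μ (c μ ν)) (expNegI ζ) :=
        Finset.sum_congr rfl fun μ _ => by rw [hd, piT_eq_genFun, genFun_delta (hc μ ν) hba hw μ]
    _ = genFun (fun x => ∑ μ, delta μ (c μ ν) x) (expNegI ζ) :=
        (B12Rep537.genFun_sum_of_summable Finset.univ hs).symm
    _ = 0 := by
        rw [show (fun x => ∑ μ, delta μ (c μ ν) x) = fun _ => (0 : ℂ) from funext (hW ν)]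
        unfold genFun
        simp

/-- **(5.15), second member** «Σ_ν ∂_ν(ζ)Π_{μν}(ζ) = 0» on the open polystrip `|q_μ| < a`, from the second member of (5.9)
`Σ_ν ∂_νΠ_{μν} = 0` (forward differences `B12Rep537.fdelta`, symbol `w_ν⁻¹ − 1 = ∂_ν(ζ)` at `w = e^{−iζ}`:
`B12Rep537.genFun_fdelta`). [cite: Balaban1987RG1, (5.15) p.293] -/
theorem eq515_right {a M : ℝ} (ha : 0 < a) {c : Fin d → Fin d → Pt d → ℂ} (hc : ∀ μ ν, ExpBound a M (c μ ν))
    (hW : ∀ (μ : Fin d) (x : Pt d), ∑ ν, B12Rep537.fdelta ν (c μ ν) x = 0) (μ : Fin d) {ζ : Fin d → ℂ}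
    (hζ : ζ ∈ PolyStrip d a) : ∑ ν, dSym ζ ν * piT (c μ ν) ζ = 0 := by
  obtain ⟨b, hba, hζb⟩ := exists_polyStrip_lt hζ
  have hw : expNegI ζ ∈ PolyAnnulus d b := expNegI_mem_polyAnnulus (polyStrip_subset_closed hζb)
  have hd : ∀ ν, dSym ζ ν = (expNegI ζ ν)⁻¹ - 1 := fun ν => by
    simp [dSym, expNegI, Complex.exp_neg]
  have hs : ∀ ν ∈ (Finset.univ : Finset (Fin d)),
      Summable fun n => B12Rep537.fdelta ν (c μ ν) n * zpowv (expNegI ζ) n :=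
    fun ν _ => (B12Rep537.fdelta_bound ha (hc μ ν) ν).summable_mul_zpowv hba hw
  calc ∑ ν, dSym ζ ν * piT (c μ ν) ζ = ∑ ν, genFun (B12Rep537.fdelta ν (c μ ν)) (expNegI ζ) :=
        Finset.sum_congr rfl fun ν _ => by
          rw [hd, piT_eq_genFun, B12Rep537.genFun_fdelta (hc μ ν) hba hw ν]
    _ = genFun (fun x => ∑ ν, B12Rep537.fdelta ν (c μ ν) x) (expNegI ζ) :=
        (B12Rep537.genFun_sum_of_summable Finset.univ hs).symm
    _ = 0 := by
        rw [show (fun x => ∑ ν, B12Rep537.fdelta ν (c μ ν) x) = fun _ => (0 : ℂ) from funext (hW μ)]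
        unfold genFun
        simp


/-! ## §9. (5.13) for `Π̃_{μν}(ζ)` (v1.1, append-only) -/

/-- The phase is additive in the lattice point (complex momenta): `ζ·(x − y) = ζ·x − ζ·y`. [folklore] -/
private theorem phaseC_sub (ζ : Fin d → ℂ) (x y : Pt d) : phaseC ζ (x - y) = phaseC ζ x - phaseC ζ y := by
  unfold phaseC
  rw [← Finset.sum_sub_distrib]
  exact Finset.sum_congr rfl fun μ _ => by push_cast [Pi.sub_apply]; ring

/-- `ε_κ² = 1` for a sign `ε_κ = ±1`. [folklore] -/
private theorem sgn_mul_self (e : ℤˣ) : ((e : ℤ) : ℂ) * ((e : ℤ) : ℂ) = 1 := by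
  have h : ((e * e : ℤˣ) : ℤ) = 1 := by rw [Int.units_mul_self, Units.val_one]
  rw [Units.val_mul] at h
  exact_mod_cast h

/-- `ε(εx) = x`: the sign flip of (5.19) is an involution of `ℤ^d`. [cite: Balaban1987RG1, (5.13) p.293] -/
theorem flipPt_flipPt (ε : Fin d → ℤˣ) (x : Pt d) : B12Rep526Coeff.flipPt ε (B12Rep526Coeff.flipPt ε x) = x := by
  have h : ε * ε = 1 := funext fun κ => Int.units_mul_self (ε κ)
  rw [← B12Rep526Coeff.flipPt_mul, h, B12Rep526Coeff.flipPt_one]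

/-- The sign flip `x ↦ εx` as a permutation of `ℤ^d` (for re-indexing the series (5.11)). [cite: Balaban1987RG1, (5.13) p.293] -/
def flipEquiv (ε : Fin d → ℤˣ) : Equiv.Perm (Pt d) :=
  Function.Involutive.toPerm (B12Rep526Coeff.flipPt ε) (flipPt_flipPt ε)

/-- `(εζ)·(εx) = ζ·x`. [cite: Balaban1987RG1, (5.13) p.293] -/
theorem phaseC_flip (ε : Fin d → ℤˣ) (ζ : Fin d → ℂ) (x : Pt d) :
    phaseC (fun κ => ((ε κ : ℤ) : ℂ) * ζ κ) (B12Rep526Coeff.flipPt ε x) = phaseC ζ x := by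
  unfold phaseC B12Rep526Coeff.flipPt
  refine Finset.sum_congr rfl fun κ _ => ?_
  push_cast
  calc ((ε κ : ℤ) : ℂ) * ζ κ * (((ε κ : ℤ) : ℂ) * (x κ : ℂ))
      = (((ε κ : ℤ) : ℂ) * ((ε κ : ℤ) : ℂ)) * (ζ κ * (x κ : ℂ)) := by ring
    _ = ζ κ * (x κ : ℂ) := by rw [sgn_mul_self, one_mul]

/-- `(1 − ε_κ)/2` (`∈ {0, 1}`) is the integer `B12Rep526Coeff.half ε_κ`. [cite: Balaban1987RG1, (5.13) p.293] -/
theorem half_cast (e : ℤˣ) : ((1 : ℂ) - ((e : ℤ) : ℂ)) / 2 = ((B12Rep526Coeff.half e : ℤ) : ℂ) := by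
  rcases Int.units_eq_one_or e with rfl | rfl
  · simp [B12Rep526Coeff.half]
  · have hne : (-1 : ℤˣ) ≠ 1 := by decide
    norm_num [B12Rep526Coeff.half, hne]

/-- The phase of the half-bond shift of (5.19): `ζ·s(ε) = −((1−ε_μ)/2)ζ_μ + ((1−ε_ν)/2)ζ_ν`.
[cite: Balaban1987RG1, (5.13) p.293] -/
theorem phaseC_shiftPt (ζ : Fin d → ℂ) (μ ν : Fin d) (ε : Fin d → ℤˣ) :
    phaseC ζ (B12Rep526Coeff.shiftPt μ ν ε)
      = -(((B12Rep526Coeff.half (ε μ) : ℤ) : ℂ) * ζ μ) + ((B12Rep526Coeff.half (ε ν) : ℤ) : ℂ) * ζ ν := by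
  unfold phaseC B12Rep526Coeff.shiftPt
  simp only [Int.cast_add, Int.cast_ite, Int.cast_neg, Int.cast_zero, mul_add, Finset.sum_add_distrib, mul_ite,
    mul_zero, Finset.sum_ite_eq', Finset.mem_univ, if_true]
  ring

/-- **(5.13)** «Π_{μν}(εζ) = ε_με_ν exp(−i((1−ε_μ)/2)ζ_μ) exp(i((1−ε_ν)/2)ζ_ν) Π_{μν}(ζ)» for a reflection `ε` in a part of the
components (`(εζ)_κ = ε_κζ_κ`, `ε_κ = ±1`), at EVERY `ζ ∈ ℂ^d`, from the position-space reflection law (5.7) (= (5.19) on the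
coefficient side, typed `B12Rep526Coeff.Cov519`: `Π_{μν}(εy) = ε_με_νΠ_{μν}(y + s(ε))`, `s(ε) = −((1−ε_μ)/2)e_μ + ((1−ε_ν)/2)e_ν`):
re-index the series (5.11) by `x = εy` and then by the shift `s(ε)`. [cite: Balaban1987RG1, (5.13) p.293] -/
theorem eq513 (c : Fin d → Fin d → Pt d → ℂ) {μ ν : Fin d} {ε : Fin d → ℤˣ} (h : B12Rep526Coeff.Cov519 c μ ν ε)
    (ζ : Fin d → ℂ) :
    piT (c μ ν) (fun κ => ((ε κ : ℤ) : ℂ) * ζ κ)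
      = B12Rep526.sgn (ε μ) * B12Rep526.sgn (ε ν)
          * (cexp (-(I * ((1 - ((ε μ : ℤ) : ℂ)) / 2 * ζ μ))) * cexp (I * ((1 - ((ε ν : ℤ) : ℂ)) / 2 * ζ ν)))
          * piT (c μ ν) ζ := by
  rw [half_cast, half_cast]
  unfold piT
  calc ∑' x, cexp (-(I * phaseC (fun κ => ((ε κ : ℤ) : ℂ) * ζ κ) x)) * c μ ν x
      = ∑' y, cexp (-(I * phaseC (fun κ => ((ε κ : ℤ) : ℂ) * ζ κ) (B12Rep526Coeff.flipPt ε y)))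
          * c μ ν (B12Rep526Coeff.flipPt ε y) :=
        ((flipEquiv ε).tsum_eq (fun x => cexp (-(I * phaseC (fun κ => ((ε κ : ℤ) : ℂ) * ζ κ) x)) * c μ ν x)).symm
    _ = ∑' y, cexp (-(I * phaseC ζ (y + B12Rep526Coeff.shiftPt μ ν ε - B12Rep526Coeff.shiftPt μ ν ε)))
          * (B12Rep526.sgn (ε μ) * B12Rep526.sgn (ε ν) * c μ ν (y + B12Rep526Coeff.shiftPt μ ν ε)) :=
        tsum_congr fun y => by rw [phaseC_flip, h y, add_sub_cancel_right]
    _ = ∑' z, cexp (-(I * phaseC ζ (z - B12Rep526Coeff.shiftPt μ ν ε)))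
          * (B12Rep526.sgn (ε μ) * B12Rep526.sgn (ε ν) * c μ ν z) :=
        (Equiv.addRight (B12Rep526Coeff.shiftPt μ ν ε)).tsum_eq
          (fun z => cexp (-(I * phaseC ζ (z - B12Rep526Coeff.shiftPt μ ν ε)))
            * (B12Rep526.sgn (ε μ) * B12Rep526.sgn (ε ν) * c μ ν z))
    _ = B12Rep526.sgn (ε μ) * B12Rep526.sgn (ε ν)
          * (cexp (-(I * (((B12Rep526Coeff.half (ε μ) : ℤ) : ℂ) * ζ μ)))
              * cexp (I * (((B12Rep526Coeff.half (ε ν) : ℤ) : ℂ) * ζ ν)))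
          * ∑' z, cexp (-(I * phaseC ζ z)) * c μ ν z := by
        rw [← tsum_mul_left]
        refine tsum_congr fun z => ?_
        rw [phaseC_sub, phaseC_shiftPt]
        rw [show -(I * (phaseC ζ z - (-(((B12Rep526Coeff.half (ε μ) : ℤ) : ℂ) * ζ μ)
              + ((B12Rep526Coeff.half (ε ν) : ℤ) : ℂ) * ζ ν)))
            = -(I * phaseC ζ z) + (-(I * (((B12Rep526Coeff.half (ε μ) : ℤ) : ℂ) * ζ μ))
              + I * (((B12Rep526Coeff.half (ε ν) : ℤ) : ℂ) * ζ ν)) by ring,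
          Complex.exp_add, Complex.exp_add]
        ring

/-- **(5.13) for the cell's real kernels**: if `Π` is reflection covariant in the typed sense of (5.7)
(`B12Transverse536.ReflCovariant`), then for every reflection `ε` and every `ζ ∈ ℂ^d`,
`Π̃_{μν}(εζ) = ε_με_ν e^{−i((1−ε_μ)/2)ζ_μ} e^{i((1−ε_ν)/2)ζ_ν} Π̃_{μν}(ζ)`. [cite: Balaban1987RG1, (5.13) p.293] -/
theorem eq513_of_reflCovariant {P : B12Beta.Kernel d} (hR : B12Transverse536.ReflCovariant P) (μ ν : Fin d)
    (ε : Fin d → ℤˣ) (ζ : Fin d → ℂ) :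
    piT (B12Rep526Coeff.castK P μ ν) (fun κ => ((ε κ : ℤ) : ℂ) * ζ κ)
      = B12Rep526.sgn (ε μ) * B12Rep526.sgn (ε ν)
          * (cexp (-(I * ((1 - ((ε μ : ℤ) : ℂ)) / 2 * ζ μ))) * cexp (I * ((1 - ((ε ν : ℤ) : ℂ)) / 2 * ζ ν)))
          * piT (B12Rep526Coeff.castK P μ ν) ζ :=
  eq513 (B12Rep526Coeff.castK P) (B12Rep526Coeff.cov519_of_reflCovariant hR μ ν ε) ζ

end

end Literature.MathematicalPhysics.QuantumFieldTheory.Balaban1983to89.B12Momentum511
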